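import Literature.NumberTheory.EllipticCurves.ComplexTorus
import Literature.NumberTheory.EllipticCurves.AbelianVarietyBridgeFullProofs
import Literature.NumberTheory.EllipticCurves.ComplexTorusAddProofs
import Literature.NumberTheory.EllipticCurves.ComplexTorusAnalytification
import Literature.NumberTheory.EllipticCurves.WeierstrassAddHomPoints
import Literature.NumberTheory.EllipticCurves.LatticeTransformationIdentity
import Literature.NumberTheory.EllipticCurves.CMEndomorphismOfCertificate
import Literature.NumberTheory.EllipticCurves.CMTransformationPolynomials
import Literature.NumberTheory.EllipticCurves.DivisionPolynomialTorsion
import Literature.AlgebraicGeometry.Motives.AbelianVarietyRationalMaps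
import Literature.AlgebraicGeometry.Motives.AbelianVarietyRigidity
import Literature.AlgebraicGeometry.Motives.AlgPointsSeparate
import Literature.AlgebraicGeometry.Motives.AbelianVarietyExistence
import Mathlib.AlgebraicGeometry.EllipticCurve.Affine.Point
import HarnessLib

/-!
# Every multiplier of a complex lattice is an endomorphism of the abelian variety `E_Λ`; the CM curves `ℂ/(ℤ + ℤ√-d)` with `[√-d]` for every `d ≥ 1`

Topic `Literature/NumberTheory/EllipticCurves`; a proofs-only file (theorems only: no definition, no
named fact). For a period pair `L` (lattice `Λ ⊂ ℂ`, curve `E_Λ : y² = x³ − (g₂/4)x − g₃/4` as a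
`ℂ`-GROUP SCHEME, the tree's `WeierstrassCurve.abelianVarietyOfAddHom` of `L.curve` with the
chord–tangent law, Silverman AEC III.3.6) and a multiplier `w ≠ 0`, `wΛ ⊆ Λ`:

* `exists_ringHom_of_transformation` — the CHART ALGEBRA MAP of a transformation pair: for
  `P, Q ∈ ℂ[X]` satisfying the transformation identity `(H1)`
  `f·(P'Q − PQ')² = w²(4P³ − g₂PQ² − g₃Q³)Q`, `f = 4X³ − g₂X − g₃` (Cox, *Primes of the form
  x² + ny²*, Prop. 14.9: `℘(wz) = (P/Q)(℘ z)`, `℘'(wz) = w⁻¹(P/Q)'(℘ z)℘'(z)`), the substitution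
  `x ↦ P/Q`, `y ↦ (P'Q − PQ')·y/(wQ²)` respects the Weierstrass equation
  (`transformation_identity_monic`, `mk_Y_sq`), hence defines a ring homomorphism out of the
  coordinate ring `ℂ[E_Λ]` into any ring in which `Q(x)` is inverted;
* `exists_endomorphism_of_mul_mem_lattice` — **Silverman, AEC Thm. VI.4.1 (b), the direction
  `{α : αΛ ⊆ Λ} → End(E_Λ)`, for `E_Λ` as a `ℂ`-group scheme**: there is an endomorphism `φ` of
  the abelian variety `E_Λ` acting on complex points as `π(z) ↦ π(wz)` (`π = PeriodPair.upoint`).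
  Proof: the transformation polynomials of `w` exist (`PeriodPair.exists_rationalMap_of_mul_mem`,
  Cox Thm. 10.14) and satisfy `(H1)`, `(H2)` (`PeriodPair.transformation_identities_of_rationalMap`);
  the chart algebra map is `Spec`'d to a `ℂ`-morphism on the non-empty open
  `D(Q) ⊂ Spec ℂ[E_Λ] ⊂ E_Λ` (localisation and affine chart are open immersions); Milne's
  extension theorem (`AbelianVariety.existsUnique_extension_abelianVariety`, *Abelian Varieties*
  Thm. 3.1) extends it to `f : E_Λ → E_Λ`; `g := f · f(O)⁻¹` fixes the origin, hence is a
  homomorphism (rigidity, `isMonHom_of_one_comp`, Milne Cor. 2.2 / Mumford §4 Cor. 1); on an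
  affine point `(℘ z, ℘'z/2)` with `Q(℘ z) ≠ 0`, `f` is the chart formula
  `((P/Q)(℘ z), (P'Q − PQ')(℘ z)·℘'(z)/(2wQ(℘ z)²)) = (℘(wz), ℘'(wz)/2)`, so the homomorphisms
  `p ↦ p ≫ g` and the analytic `π(z) ↦ π(wz)` (`PeriodPair.exists_addMonoidHom_toPoint_mul`) of
  the infinite group `E_Λ(ℂ)` differ by the constant `f(O)⁻¹` off a finite set, hence agree
  everywhere (`monoidHom_eq_one_of_eq_const_off_finite`);
* `exists_cmCurve_sqrt` — **the CM curves `ℂ/(ℤ + ℤ√-d)` with `[√-d]` as `AbelianVariety ℂ`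
  endomorphisms, for every `d ≥ 1`**: with `w = i√d`, `L = (1, w)` (`wΛ ⊆ Λ`), an endomorphism
  `φ₀` of `E_Λ` with `φ₀ ≫ φ₀ = -((d : ℤ) • 𝟙)` acting on points by `π(z) ↦ π(wz)` (`φ ≫ φ = -d`
  is checked on `ℂ`-points, which separate morphisms, `SchemeOver.hom_ext_of_forall_algPoints`);
  `exists_cmCurve_sqrt_neg` — the short form `∃ (E₀ : AbelianVariety ℂ) (ψ₀ : E₀ ⟶ E₀),
  E₀.dim = 1 ∧ ψ₀ ≫ ψ₀ = -(d • 𝟙 E₀)` consumed by the aiming lemma of the product trick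
  (`Motives.exists_cmWeilSurface_aimedSplitProduct_of_ne_one_of_ne_three`, van Geemen LNM 1594, 5.3:
  "`E` an elliptic curve with CM by `O_K`"; Schoen, Compositio 114 (1998) §10; Markman
  arXiv:2509.23403 §11.5 Step 2) and by `HodgeTheory.exists_weilTypeSurface_prod_isHyperbolicWeilType_all`.

Provenance: first landed on the summit side (Hodge summit, crux `WeilTwelvefoldsSqrtMinus7`, lead
seat c1: files `Theorems/HeckePrymWeilWeilTwelvefoldsSqrtMinus7CmChartAlgebra`,
`…CmEndomorphismOfMulMem`, `…CmCurveSqrt` — same statements and proofs, namespace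
`Summit.HodgeConjecture.…AmnesicSecantSheaves`); re-hosted here, under `Literature`, because the
Literature facts that need it cannot import `Summits` (CONVENTIONS §2). Everything is proved; no
definition and no named fact is introduced (D-0026).

## References

* [Cox2013] D. A. Cox, *Primes of the form x² + ny²*, 2nd ed. (2013), §10.B Thm. 10.14, §14.B
  Prop. 14.9 (PDF pp. 318–319).
* [SilvermanAEC2009] J. H. Silverman, *The Arithmetic of Elliptic Curves*, 2nd ed. (2009),
  Thm. VI.4.1 (b), Prop. VI.3.6, III.3.6.
* [Milne1986AbelianVarieties] J. S. Milne, *Abelian Varieties* (1986), §2 Cor. 2.2, §3 Thm. 3.1.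
* [MumfordAV1970] D. Mumford, *Abelian Varieties* (1970), §4 Cor. 1.
* [vanGeemen1994HodgeAV] B. van Geemen, LNM 1594 (1994), 5.3.
-/

noncomputable section

open CategoryTheory AlgebraicGeometry Polynomial MonoidalCategory CartesianMonoidalCategory
open scoped Polynomial.Bivariate MonObj
open Literature.AlgebraicGeometry Literature.AlgebraicGeometry.Motives
open WeierstrassCurve.Affine (CoordinateRing.mk)

namespace Literature.NumberTheory.EllipticCurves.CMEndomorphism

/-! ### The chart algebra map `ℂ[E_Λ] → ℂ[E_Λ][1/Q]` of a transformation pair -/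

/-- The Weierstrass polynomial of `E_Λ` is `Y² − (X³ − (g₂/4)X − g₃/4)`. [folklore] -/
theorem curve_polynomial_eq (L : PeriodPair) :
    L.curve.toAffine.polynomial = Polynomial.X ^ 2 - C (X ^ 3 + C (-L.g₂ / 4) * X + C (-L.g₃ / 4)) := by
  rw [WeierstrassCurve.Affine.polynomial]
  have h1 : L.curve.toAffine.a₁ = 0 := rfl
  have h2 : L.curve.toAffine.a₂ = 0 := rfl
  have h3 : L.curve.toAffine.a₃ = 0 := rfl
  have h4 : L.curve.toAffine.a₄ = -L.g₂ / 4 := rfl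
  have h6 : L.curve.toAffine.a₆ = -L.g₃ / 4 := rfl
  rw [h1, h2, h3, h4, h6]
  simp only [map_zero, zero_mul, add_zero]

/-- In `ℂ[E_Λ]`: `y² = x³ − (g₂/4)x − g₃/4`, i.e. `mk Y² = CoordinateRing.mk L.curve.toAffine (C f₄)`. [folklore] -/
theorem mk_Y_sq (L : PeriodPair) :
    WeierstrassCurve.Affine.CoordinateRing.mk L.curve.toAffine (Polynomial.X ^ 2) =
      WeierstrassCurve.Affine.CoordinateRing.mk L.curve.toAffine
        (C (X ^ 3 + C (-L.g₂ / 4) * X + C (-L.g₃ / 4))) := by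
  rw [← sub_eq_zero, ← map_sub, ← curve_polynomial_eq]
  exact AdjoinRoot.mk_self

/-- `(H1)` without the factor `4`: `w²(P³Q + a₄PQ³ + a₆Q⁴) = (P'Q − PQ')²(X³ + a₄X + a₆)` with
`a₄ = −g₂/4`, `a₆ = −g₃/4`. [cite: Cox2013, Prop. 14.9 (PDF pp. 318–319)] -/
theorem transformation_identity_monic (L : PeriodPair) {w : ℂ} {P Q : ℂ[X]}
    (h1 : (C 4 * X ^ 3 - C L.g₂ * X - C L.g₃) * (derivative P * Q - P * derivative Q) ^ 2 =
      C (w ^ 2) * ((C 4 * P ^ 3 - C L.g₂ * P * Q ^ 2 - C L.g₃ * Q ^ 3) * Q)) :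
    C (w ^ 2) * (P ^ 3 * Q + C (-L.g₂ / 4) * P * Q ^ 3 + C (-L.g₃ / 4) * Q ^ 4) =
      (derivative P * Q - P * derivative Q) ^ 2 * (X ^ 3 + C (-L.g₂ / 4) * X + C (-L.g₃ / 4)) := by
  have hc4 : C (4 : ℂ) * C (-L.g₂ / 4) = -C L.g₂ := by rw [← C_mul, ← C_neg]; congr 1; ring
  have hc6 : C (4 : ℂ) * C (-L.g₃ / 4) = -C L.g₃ := by rw [← C_mul, ← C_neg]; congr 1; ring
  have h4 : (C (4 : ℂ) : ℂ[X]) ≠ 0 := by rw [Ne, C_eq_zero]; norm_num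
  apply mul_left_cancel₀ h4
  generalize hDD : derivative P * Q - P * derivative Q = D at h1 ⊢
  generalize C (w ^ 2) = cw at h1 ⊢
  generalize C L.g₂ = g2 at h1 hc4 ⊢
  generalize C L.g₃ = g3 at h1 hc6 ⊢
  generalize C (-L.g₂ / 4) = a4 at hc4 ⊢
  generalize C (-L.g₃ / 4) = a6 at hc6 ⊢
  generalize (C (4 : ℂ) : ℂ[X]) = c4 at h1 hc4 hc6 ⊢
  linear_combination (-1 : ℂ[X]) * h1 + (cw * P * Q ^ 3 - D ^ 2 * X) * hc4 +
    (cw * Q ^ 4 - D ^ 2) * hc6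

/-- **The chart algebra map of a transformation pair.** For `w ≠ 0` and `P, Q ∈ ℂ[X]` satisfying
`(H1)` for `(g₂(Λ), g₃(Λ))`, and any commutative ring `S` with a map `i₀ : ℂ[E_Λ] → S` inverting
`Q(x)` (`i₀(Q)·u = 1`), there is a ring homomorphism `θ : ℂ[E_Λ] → S`, `ℂ`-linear
(`θ ∘ ℂ = i₀ ∘ ℂ`), with `θ(x) = i₀(P)·u` and `θ(y) = i₀(P'Q − PQ')·i₀(y)·u²·w⁻¹` (Cox, Prop. 14.9:
`[w](x, y) = ((P/Q)(x), w⁻¹(P/Q)'(x)·y)`; here `y = ℘'/2`). Def-free (an `∃`).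
[cite: Cox2013, Prop. 14.9 (PDF pp. 318–319)] -/
theorem exists_ringHom_of_transformation (L : PeriodPair) {w : ℂ} (hw : w ≠ 0) {P Q : ℂ[X]}
    (h1 : (C 4 * X ^ 3 - C L.g₂ * X - C L.g₃) * (derivative P * Q - P * derivative Q) ^ 2 =
      C (w ^ 2) * ((C 4 * P ^ 3 - C L.g₂ * P * Q ^ 2 - C L.g₃ * Q ^ 3) * Q))
    (S : Type) [CommRing S] (i₀ : L.curve.toAffine.CoordinateRing →+* S) (u : S)
    (hu : i₀ (WeierstrassCurve.Affine.CoordinateRing.mk L.curve.toAffine (C Q)) * u = 1) :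
    ∃ θ : L.curve.toAffine.CoordinateRing →+* S,
      θ.comp (algebraMap ℂ _) = i₀.comp (algebraMap ℂ _) ∧
      θ (WeierstrassCurve.Affine.CoordinateRing.mk L.curve.toAffine (C X)) =
        i₀ (WeierstrassCurve.Affine.CoordinateRing.mk L.curve.toAffine (C P)) * u ∧
      θ (WeierstrassCurve.Affine.CoordinateRing.mk L.curve.toAffine Polynomial.X) =
        i₀ (WeierstrassCurve.Affine.CoordinateRing.mk L.curve.toAffine
            (C (derivative P * Q - P * derivative Q))) *
          i₀ (WeierstrassCurve.Affine.CoordinateRing.mk L.curve.toAffine Polynomial.X) * u ^ 2 *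
          i₀ (algebraMap ℂ _ w⁻¹) := by
  set D : ℂ[X] := derivative P * Q - P * derivative Q with hD
  have halg : ∀ c : ℂ, algebraMap ℂ L.curve.toAffine.CoordinateRing c = CoordinateRing.mk L.curve.toAffine (C (C c)) := fun c => rfl
  -- names for the images in `S`
  set q : S := i₀ (CoordinateRing.mk L.curve.toAffine (C Q)) with hq
  set p : S := i₀ (CoordinateRing.mk L.curve.toAffine (C P)) with hp
  set d : S := i₀ (CoordinateRing.mk L.curve.toAffine (C D)) with hd
  set yy : S := i₀ (CoordinateRing.mk L.curve.toAffine Polynomial.X) with hyy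
  set ω : S := i₀ (algebraMap ℂ _ w) with hω
  set ω' : S := i₀ (algebraMap ℂ _ w⁻¹) with hω'
  set α : S := i₀ (algebraMap ℂ _ (-L.g₂ / 4)) with hα
  set β : S := i₀ (algebraMap ℂ _ (-L.g₃ / 4)) with hβ
  have hqu : q * u = 1 := hu
  have hww : ω * ω' = 1 := by
    rw [hω, hω', ← map_mul, ← map_mul, mul_inv_cancel₀ hw, map_one, map_one]
  -- the values of `x` and `y`
  set Xs : S := p * u with hXs
  set Ys : S := d * yy * u ^ 2 * ω' with hYs
  -- the polynomial identity, pushed to `S`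
  have hpoly := transformation_identity_monic L h1
  have hS : ω ^ 2 * (p ^ 3 * q + α * p * q ^ 3 + β * q ^ 4) = d ^ 2 * yy ^ 2 := by
    have e := congrArg (fun r : ℂ[X] => i₀ (CoordinateRing.mk L.curve.toAffine (C r))) hpoly
    have e2 : i₀ (CoordinateRing.mk L.curve.toAffine (C ((derivative P * Q - P * derivative Q) ^ 2 *
        (X ^ 3 + C (-L.g₂ / 4) * X + C (-L.g₃ / 4))))) = d ^ 2 * yy ^ 2 := by
      rw [map_mul, map_mul, map_mul, ← mk_Y_sq L, map_pow, map_pow, map_pow, map_pow, map_pow, ← hD]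
    have e1 : i₀ (CoordinateRing.mk L.curve.toAffine (C (C (w ^ 2) *
        (P ^ 3 * Q + C (-L.g₂ / 4) * P * Q ^ 3 + C (-L.g₃ / 4) * Q ^ 4)))) =
        ω ^ 2 * (p ^ 3 * q + α * p * q ^ 3 + β * q ^ 4) := by
      rw [hω, hα, hβ, halg, halg, halg, hp, hq]
      simp only [map_mul, map_add, map_pow]
    rw [← e1, e, e2]
  -- Main relation: `Ys² = Xs³ + α Xs + β` in `S`.
  have hrel : Ys ^ 2 - (Xs ^ 3 + α * Xs + β) = 0 := by
    have hunitQ : IsUnit q := IsUnit.of_mul_eq_one _ hqu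
    have hunitw : IsUnit ω := IsUnit.of_mul_eq_one _ hww
    apply (hunitQ.pow 4).mul_left_cancel
    apply (hunitw.pow 2).mul_left_cancel
    rw [mul_zero]
    have eL : ω ^ 2 * (q ^ 4 * Ys ^ 2) = d ^ 2 * yy ^ 2 := by
      rw [hYs]
      calc ω ^ 2 * (q ^ 4 * (d * yy * u ^ 2 * ω') ^ 2)
          = d ^ 2 * yy ^ 2 * (q * u) ^ 4 * (ω * ω') ^ 2 := by ring
        _ = d ^ 2 * yy ^ 2 := by rw [hqu, hww]; ring
    have eR : ω ^ 2 * (q ^ 4 * (Xs ^ 3 + α * Xs + β)) = ω ^ 2 * (p ^ 3 * q + α * p * q ^ 3 + β * q ^ 4) := by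
      rw [hXs]
      calc ω ^ 2 * (q ^ 4 * ((p * u) ^ 3 + α * (p * u) + β))
          = ω ^ 2 * (p ^ 3 * q * (q * u) ^ 3 + α * p * q ^ 3 * (q * u) + β * q ^ 4) := by ring
        _ = ω ^ 2 * (p ^ 3 * q + α * p * q ^ 3 + β * q ^ 4) := by rw [hqu]; ring
    rw [mul_zero, mul_sub, mul_sub, eL, eR, hS, sub_self]
  -- `ℂ[X] → S`, `X ↦ Xs`, and the lift through the Weierstrass relation
  set i : ℂ[X] →+* S := eval₂RingHom (i₀.comp (algebraMap ℂ L.curve.toAffine.CoordinateRing)) Xs with hi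
  have hiC : ∀ c : ℂ, i (C c) = i₀ (algebraMap ℂ _ c) := fun c => by
    rw [hi, coe_eval₂RingHom, eval₂_C, RingHom.comp_apply]
  have hiX : i X = Xs := by rw [hi, coe_eval₂RingHom, eval₂_X]
  have hroot : L.curve.toAffine.polynomial.eval₂ i Ys = 0 := by
    rw [curve_polynomial_eq, eval₂_sub, eval₂_pow, eval₂_X, eval₂_C, map_add, map_add, map_mul,
      map_pow, hiX, hiC, hiC, ← hα, ← hβ]
    exact hrel
  refine ⟨AdjoinRoot.lift i Ys hroot, ?_, ?_, ?_⟩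
  · refine RingHom.ext fun c => ?_
    rw [RingHom.comp_apply, RingHom.comp_apply, halg]
    change AdjoinRoot.lift i Ys hroot (AdjoinRoot.mk _ (C (C c))) = _
    rw [AdjoinRoot.lift_mk, eval₂_C, hiC, halg]
  · change AdjoinRoot.lift i Ys hroot (AdjoinRoot.mk _ (C X)) = _
    rw [AdjoinRoot.lift_mk, eval₂_C, hiX]
  · change AdjoinRoot.lift i Ys hroot (AdjoinRoot.mk _ Polynomial.X) = _
    rw [AdjoinRoot.lift_mk, eval₂_X]

/-! ### Every multiplier of the lattice is an endomorphism of `E_Λ` -/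

/-- **A homomorphism of an infinite abelian group which is constant off a finite set is trivial.**
If `h : G → H` is a group homomorphism, `G` infinite, and `h(p) = c` for all `p` outside a finite
set `S`, then `h = 1` (pick `p₀, p₁ ∉ S` with `p₀p₁ ∉ S`: `c = c²`; then every `p` is `(pq)q⁻¹` with
`q, pq ∉ S`). [folklore] -/
theorem monoidHom_eq_one_of_eq_const_off_finite {G H : Type*} [CommGroup G] [Infinite G] [Group H]
    (h : G →* H) {S : Set G} (hS : S.Finite) (c : H) (hc : ∀ p ∉ S, h p = c) : h = 1 := by
  have key : ∀ p : G, ∃ q : G, q ∉ S ∧ p * q ∉ S := fun p => by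
    have hfin : (S ∪ (fun q => p * q) ⁻¹' S).Finite :=
      hS.union (hS.preimage (Set.injOn_of_injective (mul_right_injective p)))
    obtain ⟨q, hq⟩ := hfin.infinite_compl.nonempty
    exact ⟨q, fun h1 => hq (Or.inl h1), fun h2 => hq (Or.inr h2)⟩
  obtain ⟨p₀, hp₀⟩ := hS.infinite_compl.nonempty
  obtain ⟨p₁, hp₁, hp₀₁⟩ := key p₀
  have hc1 : c = 1 := by
    have e : h (p₀ * p₁) = h p₀ * h p₁ := map_mul h p₀ p₁
    rw [hc _ hp₀₁, hc _ hp₀, hc _ hp₁] at e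
    have e' : c * c = c * 1 := by rw [mul_one]; exact e.symm
    exact mul_left_cancel e'
  ext p
  obtain ⟨q, hq, hpq⟩ := key p
  have e : h p = h (p * q) * (h q)⁻¹ := by rw [map_mul, mul_inv_cancel_right]
  rw [e, hc _ hpq, hc _ hq, hc1, MonoidHom.one_apply, one_mul, inv_one]

/-- **Every multiplier of the period lattice is an endomorphism of the abelian variety `E_Λ`** (Silverman,
*AEC* Thm. VI.4.1 (b), the direction `{α : αΛ ⊆ Λ} → End(E_Λ)`, for `E_Λ` as a `ℂ`-GROUP SCHEME): for a period
pair `L` and `w ≠ 0` with `wΛ ⊆ Λ` there is an endomorphism `φ` of the abelian variety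
`WeierstrassCurve.abelianVarietyOfAddHom` of `L.curve` whose action on complex points is `π(z) ↦ π(wz)`,
`π = PeriodPair.upoint`. Proof: the transformation polynomials `℘(wz) = (P/Q)(℘ z)` exist
(`PeriodPair.exists_rationalMap_of_mul_mem`, Cox Thm. 10.14) and satisfy `(H1)`, `(H2)`
(`transformation_identities_of_rationalMap`); the chart algebra map of `(H1)` is `Spec`'d to a
`ℂ`-morphism on the open `D(Q) ⊂ E_Λ`, extended by Milne's theorem, corrected at the origin and made a
homomorphism by rigidity; it agrees with `π(z) ↦ π(wz)` off the finitely many classes of `w⁻¹Λ/Λ`, hence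
everywhere. Def-free. [cite: Cox2013, §10.B Thm. 10.14 and Prop. 14.9] [cite: Milne1986AbelianVarieties, §3 Thm. 3.1] -/
theorem exists_endomorphism_of_mul_mem_lattice (L : PeriodPair) {w : ℂ} (hw : w ≠ 0)
    (hwΛ : ∀ l ∈ L.lattice, w * l ∈ L.lattice) :
    ∃ φ : (L.curve.abelianVarietyOfAddHom L.curve.addHom L.curve.negHom L.curve.lift_pointEquiv_comp_addHom
          L.curve.pointEquiv_comp_negHom_geom) ⟶
        (L.curve.abelianVarietyOfAddHom L.curve.addHom L.curve.negHom L.curve.lift_pointEquiv_comp_addHom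
          L.curve.pointEquiv_comp_negHom_geom),
      ∀ z : ℂ, L.upoint z ≫ φ.hom.hom.hom = L.upoint (w * z) := by
  -- the transformation polynomials of `w`
  obtain ⟨P, Q, hQ, hPQ⟩ := L.exists_rationalMap_of_mul_mem hw hwΛ
  obtain ⟨h1, h2⟩ := L.transformation_identities_of_rationalMap hw hwΛ hPQ
  -- the coordinate ring and the localisation at `Q(x)`
  let A : Type := L.curve.toAffine.CoordinateRing
  let qA : A := CoordinateRing.mk L.curve.toAffine (C Q)
  let SL : Type := Localization.Away qA
  have hu : algebraMap A SL qA * IsLocalization.Away.invSelf qA = 1 := IsLocalization.Away.mul_invSelf qA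
  obtain ⟨θ, hθC, hθx, hθy⟩ := exists_ringHom_of_transformation L hw h1 SL (algebraMap A SL)
    (IsLocalization.Away.invSelf qA) hu
  -- the abelian variety and the open immersion `Spec SL → Spec A → E`
  let E : AbelianVariety ℂ := L.curve.abelianVarietyOfAddHom L.curve.addHom L.curve.negHom
    L.curve.lift_pointEquiv_comp_addHom L.curve.pointEquiv_comp_negHom_geom
  have hEX : E.X = L.curve.scheme := rfl
  let jS : Spec (CommRingCat.of SL) ⟶ Spec (CommRingCat.of A) :=
    Spec.map (CommRingCat.ofHom (algebraMap A SL))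
  haveI : IsOpenImmersion jS := inferInstance
  let jj : Spec (CommRingCat.of SL) ⟶ L.curve.scheme.left := jS ≫ L.curve.chartHom
  haveI hjj : IsOpenImmersion jj := inferInstanceAs (IsOpenImmersion (jS ≫ L.curve.chartHom))
  let U : L.curve.scheme.left.Opens := jj.opensRange
  let g : (U : Scheme) ⟶ L.curve.scheme.left :=
    jj.isoOpensRange.inv ≫ Spec.map (CommRingCat.ofHom θ) ≫ L.curve.chartHom
  have hstr : L.curve.chartHom ≫ L.curve.scheme.hom = Spec.map (CommRingCat.ofHom (algebraMap ℂ A)) :=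
    L.curve.affineChart_over
  have hg : g ≫ L.curve.scheme.hom = U.ι ≫ L.curve.scheme.hom := by
    have e1 : U.ι = jj.isoOpensRange.inv ≫ jj := (jj.isoOpensRange_inv_comp).symm
    rw [e1]
    change (jj.isoOpensRange.inv ≫ Spec.map (CommRingCat.ofHom θ) ≫ L.curve.chartHom) ≫ L.curve.scheme.hom =
      (jj.isoOpensRange.inv ≫ jS ≫ L.curve.chartHom) ≫ L.curve.scheme.hom
    simp only [Category.assoc]
    rw [hstr, ← Spec.map_comp, ← Spec.map_comp, ← CommRingCat.ofHom_comp, ← CommRingCat.ofHom_comp, hθC]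
  have hqA : qA ≠ 0 := by
    intro h0
    have h1' : Q • (1 : A) + (0 : ℂ[X]) • CoordinateRing.mk L.curve.toAffine Polynomial.X = 0 := by
      rw [zero_smul, add_zero, WeierstrassCurve.Affine.CoordinateRing.smul, mul_one]
      exact h0
    exact hQ (WeierstrassCurve.Affine.CoordinateRing.smul_basis_eq_zero h1').1
  haveI : IsDomain SL :=
    IsLocalization.isDomain_localization (powers_le_nonZeroDivisors_of_noZeroDivisors hqA)
  have hUne : (U : Set L.curve.scheme.left).Nonempty := by
    change (Set.range _).Nonempty
    exact Set.range_nonempty _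
  obtain ⟨f, hf, -⟩ := AbelianVariety.existsUnique_extension_abelianVariety (A := E) E U hUne g hg
  set fl : L.curve.scheme.left ⟶ L.curve.scheme.left := f.left with hfl
  have hf' : (U.ι ≫ fl : (U : Scheme) ⟶ L.curve.scheme.left) = g := hf
  -- ### the chart formula: on affine points with `Q(x) ≠ 0`, `f` is `(x, y) ↦ (P/Q, D·y/(wQ²))`
  set D : ℂ[X] := derivative P * Q - P * derivative Q with hD
  have hjj : jS ≫ L.curve.chartHom = jj.isoOpensRange.hom ≫ U.ι := (jj.isoOpensRange_hom_ι).symm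
  have chart : ∀ (x y : ℂ) (h : L.curve.toAffine.Nonsingular x y), Q.eval x ≠ 0 →
      ∃ h' : L.curve.toAffine.Nonsingular (P.eval x * (Q.eval x)⁻¹)
        (D.eval x * y * (Q.eval x)⁻¹ ^ 2 * w⁻¹),
      L.curve.pointEquiv (WeierstrassCurve.Affine.Point.some x y h : L.curve.toAffine.Point) ≫ f =
        L.curve.pointEquiv (WeierstrassCurve.Affine.Point.some _ _ h' : L.curve.toAffine.Point) := by
    intro x y h hQx
    -- evaluation at `(x, y)` and its factorisation through `A[1/Q]`
    let ev : A →ₐ[ℂ] ℂ := L.curve.affineEval x y h.1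
    have hev : ∀ p : ℂ[X], ev (CoordinateRing.mk L.curve.toAffine (C p)) = p.eval x := fun p => by
      change (AdjoinRoot.liftAlgHom _ _ _ _) (AdjoinRoot.mk _ (C p)) = _
      rw [AdjoinRoot.coe_liftAlgHom, AdjoinRoot.lift_mk, eval₂_C, AlgHom.toRingHom_eq_coe,
        AlgHom.coe_toRingHom, Polynomial.coe_aeval_eq_eval]
    have hevy : ev (CoordinateRing.mk L.curve.toAffine Polynomial.X) = y := L.curve.affineEval_yClass x y h.1
    have hunit : IsUnit (ev.toRingHom qA) := by
      rw [AlgHom.toRingHom_eq_coe, AlgHom.coe_toRingHom, hev]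
      exact (IsUnit.mk0 _ hQx)
    let evS : SL →+* ℂ := IsLocalization.Away.lift qA hunit
    have hevS : ∀ a : A, evS (algebraMap A SL a) = ev a := fun a => IsLocalization.Away.lift_eq qA hunit a
    have hevSu : evS (IsLocalization.Away.invSelf qA) = (Q.eval x)⁻¹ := by
      have e := congrArg evS hu
      rw [map_mul, map_one, hevS] at e
      change ev (CoordinateRing.mk L.curve.toAffine (C Q)) * _ = 1 at e
      rw [hev] at e
      exact (eq_inv_of_mul_eq_one_right e)
    -- the composite `evS ∘ θ` is the evaluation at `(x', y')`
    have hcompC : ∀ c : ℂ, evS (θ (algebraMap ℂ A c)) = c := fun c => by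
      have e := congrArg (fun φ : ℂ →+* SL => evS (φ c)) hθC
      simp only [RingHom.comp_apply] at e
      rw [e, hevS, AlgHom.commutes]
      rfl
    let ψ : A →ₐ[ℂ] ℂ :=
      { toRingHom := evS.comp θ
        commutes' := fun c => by
          rw [RingHom.toFun_eq_coe, RingHom.comp_apply]
          exact hcompC c }
    have hψx : ψ (WeierstrassCurve.xClass L.curve) = P.eval x * (Q.eval x)⁻¹ := by
      change evS (θ (CoordinateRing.mk L.curve.toAffine (C X))) = _
      rw [hθx, map_mul, hevS, hevSu]
      rw [hev]
    have hψy : ψ (WeierstrassCurve.yClass L.curve) = D.eval x * y * (Q.eval x)⁻¹ ^ 2 * w⁻¹ := by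
      change evS (θ (CoordinateRing.mk L.curve.toAffine Polynomial.X)) = _
      rw [hθy, map_mul, map_mul, map_mul, map_pow, hevS, hevS, hevSu, hevS]
      rw [hev, hevy, AlgHom.commutes]
      rfl
    have hEq' := L.curve.equation_algHom ψ
    rw [hψx, hψy] at hEq'
    have h' : L.curve.toAffine.Nonsingular (P.eval x * (Q.eval x)⁻¹)
        (D.eval x * y * (Q.eval x)⁻¹ ^ 2 * w⁻¹) :=
      (WeierstrassCurve.Affine.equation_iff_nonsingular.mp hEq')
    refine ⟨h', ?_⟩
    have hψev : ψ = L.curve.affineEval _ _ h'.1 :=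
      L.curve.affine_algHom_ext (by rw [hψx, WeierstrassCurve.affineEval_xClass])
        (by rw [hψy, WeierstrassCurve.affineEval_yClass])
    -- compare the underlying morphisms of schemes
    have hPt : L.curve.pointEquiv (WeierstrassCurve.Affine.Point.some x y h : L.curve.toAffine.Point) =
        L.curve.chartPoint (X := L.curve.scheme) L.curve.affineChart.left L.curve.affineChart_over x y h.1 := by
      change L.curve.pointEquiv (WeierstrassCurve.Affine.Point.some x y h) = _
      rw [WeierstrassCurve.pointEquiv_some]; exact (L.curve.chartPoint_affineChart x y h.1).symm
    have hPt' : L.curve.pointEquiv (WeierstrassCurve.Affine.Point.some _ _ h' : L.curve.toAffine.Point) =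
        L.curve.chartPoint (X := L.curve.scheme) L.curve.affineChart.left L.curve.affineChart_over _ _ h'.1 := by
      change L.curve.pointEquiv (WeierstrassCurve.Affine.Point.some _ _ h') = _
      rw [WeierstrassCurve.pointEquiv_some]; exact (L.curve.chartPoint_affineChart _ _ h'.1).symm
    rw [hPt, hPt']
    refine Over.OverMorphism.ext ?_
    rw [Over.comp_left, WeierstrassCurve.chartPoint_left, WeierstrassCurve.chartPoint_left, ← hψev]
    have hfac : Spec.map (CommRingCat.ofHom ev.toRingHom) = Spec.map (CommRingCat.ofHom evS) ≫ jS := by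
      rw [← Spec.map_comp, ← CommRingCat.ofHom_comp, IsLocalization.Away.lift_comp]
    change (Spec.map (CommRingCat.ofHom ev.toRingHom) ≫ L.curve.chartHom) ≫ fl =
      Spec.map (CommRingCat.ofHom (evS.comp θ)) ≫ L.curve.chartHom
    rw [hfac]
    simp only [Category.assoc]
    rw [reassoc_of% hjj, hf']
    change Spec.map (CommRingCat.ofHom evS) ≫ jj.isoOpensRange.hom ≫ jj.isoOpensRange.inv ≫
      Spec.map (CommRingCat.ofHom θ) ≫ L.curve.chartHom = _
    rw [Iso.hom_inv_id_assoc, ← Spec.map_comp_assoc, ← CommRingCat.ofHom_comp]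
  -- ### (L2) on the uniformisation: `π(z) ≫ f = π(wz)` for `z ∉ Λ`, `Q(℘ z) ≠ 0`
  have some_eq : ∀ {x y x' y' : ℂ} (hx : x = x') (hy : y = y')
      (hh : L.curve.toAffine.Nonsingular x y) (hh' : L.curve.toAffine.Nonsingular x' y'),
      (WeierstrassCurve.Affine.Point.some x y hh : L.curve.toAffine.Point) =
        WeierstrassCurve.Affine.Point.some x' y' hh' := by
    intro x y x' y' hx hy hh hh'; subst hx; subst hy; rfl
  have anal : ∀ z : ℂ, z ∉ L.lattice → w * z ∉ L.lattice → L.upoint z ≫ f = L.upoint (w * z) := by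
    intro z hz hwz
    obtain ⟨hQz, hPz⟩ := hPQ z hwz
    have hP : P.eval (L.weierstrassP z) = L.weierstrassP (w * z) * Q.eval (L.weierstrassP z) := by
      rw [hPz, div_mul_cancel₀ _ hQz]
    -- the derivative of the transformation identity at `z` (Cox, Prop. 14.9: `℘'(wz) = w⁻¹R'(℘ z)℘'(z)`)
    have hP' : w * L.derivWeierstrassP (w * z) * Q.eval (L.weierstrassP z) ^ 2 =
        D.eval (L.weierstrassP z) * L.derivWeierstrassP z := by
      have hopen : IsOpen ((L.lattice : Set ℂ)ᶜ) := L.isClosed_lattice.isOpen_compl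
      set Fz : ℂ → ℂ := fun ζ => P.eval (L.weierstrassP ζ) - L.weierstrassP (w * ζ) * Q.eval (L.weierstrassP ζ)
        with hFz
      have hFev : Fz =ᶠ[nhds z] fun _ => 0 := by
        have e2 : ∀ᶠ ζ : ℂ in nhds z, w * ζ ∉ L.lattice := by
          have hc1 : Continuous fun ζ : ℂ => w * ζ := by fun_prop
          exact hc1.continuousAt.preimage_mem_nhds (hopen.mem_nhds hwz)
        filter_upwards [e2] with ζ h2'
        obtain ⟨hQζ, hPζ⟩ := hPQ ζ h2'
        simp only [hFz, hPζ, div_mul_cancel₀ _ hQζ, sub_self]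
      have hdP : HasDerivAt (fun ζ => P.eval (L.weierstrassP ζ))
          ((derivative P).eval (L.weierstrassP z) * L.derivWeierstrassP z) z :=
        (P.hasDerivAt (L.weierstrassP z)).comp z (L.hasDerivAt_weierstrassP hz)
      have hdQ : HasDerivAt (fun ζ => Q.eval (L.weierstrassP ζ))
          ((derivative Q).eval (L.weierstrassP z) * L.derivWeierstrassP z) z :=
        (Q.hasDerivAt (L.weierstrassP z)).comp z (L.hasDerivAt_weierstrassP hz)
      have hd℘ : HasDerivAt (fun ζ : ℂ => L.weierstrassP (w * ζ)) (L.derivWeierstrassP (w * z) * w) z := by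
        have e1 : HasDerivAt (fun ζ : ℂ => w * ζ) w z := by simpa using (hasDerivAt_id z).const_mul w
        exact HasDerivAt.comp (h₂ := L.weierstrassP) (h := fun ζ : ℂ => w * ζ) z (L.hasDerivAt_weierstrassP hwz) e1
      have hdF : HasDerivAt Fz ((derivative P).eval (L.weierstrassP z) * L.derivWeierstrassP z -
          (L.derivWeierstrassP (w * z) * w * Q.eval (L.weierstrassP z) +
            L.weierstrassP (w * z) * ((derivative Q).eval (L.weierstrassP z) * L.derivWeierstrassP z))) z :=
        hdP.sub (hd℘.mul hdQ)
      have hdF0 : HasDerivAt Fz 0 z := (hasDerivAt_const z (0 : ℂ)).congr_of_eventuallyEq hFev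
      have hderiv := hdF.unique hdF0
      rw [hD, eval_sub, eval_mul, eval_mul]
      linear_combination -(Q.eval (L.weierstrassP z)) * hderiv +
        (derivative Q).eval (L.weierstrassP z) * L.derivWeierstrassP z * hP
    obtain ⟨h', hch⟩ := chart (L.weierstrassP z) (L.derivWeierstrassP z / 2) (PeriodPair.nonsingular_weierstrassP hz) hQz
    rw [PeriodPair.upoint, PeriodPair.toPoint_of_notMem hz, hch, PeriodPair.upoint, PeriodPair.toPoint_of_notMem hwz]
    congr 1
    apply some_eq
    · rw [hP, mul_assoc, mul_inv_cancel₀ hQz, mul_one]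
    · have hQ2 : Q.eval (L.weierstrassP z) ^ 2 ≠ 0 := pow_ne_zero 2 hQz
      have hA : L.derivWeierstrassP (w * z) =
          (w * Q.eval (L.weierstrassP z) ^ 2)⁻¹ * (D.eval (L.weierstrassP z) * L.derivWeierstrassP z) := by
        rw [eq_inv_mul_iff_mul_eq₀ (mul_ne_zero hw hQ2)]
        linear_combination hP'
      rw [hA]
      ring
  -- ### (L5) origin correction, rigidity, and the endomorphism
  let κ : 𝟙_ (SchemeOver ℂ) ⟶ E.X := η[E.X] ≫ f
  let g₁ : E.X ⟶ E.X := f * (toUnit E.X ≫ κ)⁻¹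
  have hηt : η[E.X] ≫ toUnit E.X = 𝟙 _ := Subsingleton.elim _ _
  have hg₁ : η[E.X] ≫ g₁ = η[E.X] := by
    change η[E.X] ≫ (f * (toUnit E.X ≫ κ)⁻¹) = η[E.X]
    rw [MonObj.comp_mul, GrpObj.comp_inv, ← Category.assoc, hηt, Category.id_comp, mul_inv_cancel,
      ← MonObj.one_eq_one]
  haveI : IsMonHom g₁ := isMonHom_of_one_comp (A := E) (B := E) g₁ hg₁
  refine ⟨InducedCategory.homMk (Grp.homMk g₁), ?_⟩
  change ∀ z : ℂ, L.upoint z ≫ g₁ = L.upoint (w * z)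
  -- the two homomorphisms of `E(ℂ)`: `p ↦ p ≫ g₁` and the analytic `π(z) ↦ π(wz)`
  letI instGrp : GrpObj L.curve.scheme := E.grpObj
  haveI instComm : IsCommMonObj L.curve.scheme := AbelianVariety.instIsCommMonObj E
  let g₁' : L.curve.scheme ⟶ L.curve.scheme := g₁
  haveI : IsMonHom g₁' := ‹IsMonHom g₁›
  let f' : L.curve.scheme ⟶ L.curve.scheme := f
  let κ' : 𝟙_ (SchemeOver ℂ) ⟶ L.curve.scheme := κ
  have hg₁' : g₁' = f' * (toUnit L.curve.scheme ≫ κ')⁻¹ := rfl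
  change ∀ z : ℂ, L.upoint z ≫ g₁' = L.upoint (w * z)
  let pe : L.curve.toAffine.Point ≃ AlgPoints L.curve.scheme ℂ := L.curve.pointEquiv (L := ℂ)
  have hupt : ∀ z : ℂ, L.upoint z = pe (L.toPoint z) := fun z => rfl
  haveI : Infinite L.curve.toAffine.Point := WeierstrassCurve.infinite_point (V := L.curve)
  haveI : Infinite (AlgPoints L.curve.scheme ℂ) := Infinite.of_injective pe pe.injective
  let F : AlgPoints L.curve.scheme ℂ →* AlgPoints L.curve.scheme ℂ :=
    { toFun := fun p => p ≫ g₁'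
      map_one' := MonObj.one_comp g₁'
      map_mul' := fun p q => MonObj.mul_comp p q g₁' }
  obtain ⟨Aw, hAw⟩ := L.exists_addMonoidHom_toPoint_mul hwΛ
  have hmul : ∀ a b : L.curve.toAffine.Point, pe (a + b) = pe a * pe b := by
    intro a b
    change L.curve.pointEquiv (a + b) = lift (L.curve.pointEquiv a) (L.curve.pointEquiv b) ≫ L.curve.addHom
    exact (L.curve.lift_pointEquiv_comp_addHom_of_field (L := ℂ) a b).symm
  have h1pt : pe 0 = 1 := by
    have e := hmul 0 0
    rw [add_zero] at e
    have e' : pe 0 * pe 0 = pe 0 * 1 := by rw [mul_one]; exact e.symm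
    exact mul_left_cancel e'
  have hsymm_mul : ∀ p q : AlgPoints L.curve.scheme ℂ, pe.symm (p * q) = pe.symm p + pe.symm q := by
    intro p q
    apply pe.injective
    rw [hmul, Equiv.apply_symm_apply, Equiv.apply_symm_apply, Equiv.apply_symm_apply]
  have hsymm_one : pe.symm 1 = 0 := by
    apply pe.injective
    rw [Equiv.apply_symm_apply, h1pt]
  let αw : AlgPoints L.curve.scheme ℂ →* AlgPoints L.curve.scheme ℂ :=
    { toFun := fun p => pe (Aw (pe.symm p))
      map_one' := by
        change pe (Aw (pe.symm 1)) = 1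
        rw [hsymm_one, map_zero, h1pt]
      map_mul' := fun p q => by
        rw [hsymm_mul, map_add, hmul] }
  have hαw : ∀ z : ℂ, αw (L.upoint z) = L.upoint (w * z) := fun z => by
    change pe (Aw (pe.symm (L.upoint z))) = _
    rw [hupt, hupt, Equiv.symm_apply_apply, hAw]
  -- the exceptional finite set: the classes of `w⁻¹Λ/Λ`
  obtain ⟨Srep, -, hSrep, -⟩ := L.exists_reps_of_mul_mem hw hwΛ
  let S : Set (AlgPoints L.curve.scheme ℂ) := (fun c : ℂ => L.upoint c) '' (Srep : Set ℂ)
  have hS : S.Finite := (Srep : Set ℂ).toFinite.image _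
  -- off `S`, `F / αw` is the constant `c⁻¹`, `c = f(O)`
  let c : AlgPoints L.curve.scheme ℂ := toUnit (specOver ℂ ℂ) ≫ κ'
  have hFα : ∀ p : AlgPoints L.curve.scheme ℂ, p ∉ S → (F / αw) p = c⁻¹ := by
    intro p hp
    obtain ⟨z, rfl⟩ := L.upoint_surjective p
    have hwz : w * z ∉ L.lattice := fun hwz => by
      obtain ⟨c, hc, hzc⟩ := (hSrep z).mp hwz
      exact hp ⟨c, hc, (PeriodPair.upoint_eq_upoint_iff.mpr hzc).symm⟩
    have hz : z ∉ L.lattice := fun hz => hwz (hwΛ z hz)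
    rw [MonoidHom.div_apply, hαw]
    change (L.upoint z ≫ g₁') / L.upoint (w * z) = c⁻¹
    rw [hg₁', MonObj.comp_mul, GrpObj.comp_inv, ← Category.assoc, comp_toUnit]
    have hanal : L.upoint z ≫ f' = L.upoint (w * z) := anal z hz hwz
    rw [hanal]
    change L.upoint (w * z) * c⁻¹ / L.upoint (w * z) = c⁻¹
    rw [mul_comm, mul_div_assoc, div_self', mul_one]
  have hF : F / αw = 1 := monoidHom_eq_one_of_eq_const_off_finite (F / αw) hS c⁻¹ hFα
  intro z
  have e := congrArg (fun m : AlgPoints L.curve.scheme ℂ →* AlgPoints L.curve.scheme ℂ => m (L.upoint z)) hF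
  simp only [MonoidHom.div_apply, MonoidHom.one_apply, div_eq_one] at e
  rw [← hαw z, ← e]
  rfl

/-! ### The CM curves `ℂ/(ℤ + ℤ√-d)` with `[√-d]`, every `d ≥ 1` -/

/-- `1` and a non-real complex number are `ℝ`-linearly independent. [folklore] -/
theorem linearIndependent_one_of_im_ne_zero {w : ℂ} (hw : w.im ≠ 0) : LinearIndependent ℝ ![(1 : ℂ), w] := by
  refine LinearIndependent.pair_iff.mpr fun s t hst => ?_
  have him := congrArg Complex.im hst
  simp only [Complex.add_im, Complex.smul_im, Complex.one_im, mul_zero, zero_add, smul_eq_mul,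
    Complex.zero_im] at him
  have ht : t = 0 := (mul_eq_zero.mp him).resolve_right hw
  have hre := congrArg Complex.re hst
  simp only [ht, zero_smul, add_zero, Complex.smul_re, Complex.one_re, smul_eq_mul, mul_one,
    Complex.zero_re] at hre
  exact ⟨hre, ht⟩

section
open scoped MonObj

/-- **The CM curve `ℂ/(ℤ + ℤ√-d)` with `[√-d]` as an `AbelianVariety ℂ` endomorphism, `d ≥ 1`.** With `w = i√d`
(`w² = -d`) and the period pair `L = (1, w)`, there is an endomorphism `φ₀` of the abelian variety `E_Λ`
(`WeierstrassCurve.abelianVarietyOfAddHom` of `L.curve`) with `φ₀ ≫ φ₀ = -d·𝟙` whose action on complex points is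
`π(z) ↦ π(wz)`; `(ω₁, ω₂) = (1, w)` and the matrix of `w` on it is `N = (0 1; -d 0)` (all recorded in the statement). From
`exists_endomorphism_of_mul_mem_lattice` (every multiplier of `Λ` is an endomorphism) and faithfulness of
`ℂ`-points. [cite: SilvermanAEC2009, Thm. VI.4.1 (b)] [cite: Milne1986AbelianVarieties, §3 Thm. 3.1] -/
theorem exists_cmCurve_sqrt (d : ℕ) (hd : 0 < d) :
    ∃ (L : PeriodPair) (w : ℂ) (N : Matrix (Fin 2) (Fin 2) ℤ) (φ₀ : (L.curve.abelianVarietyOfAddHom L.curve.addHom L.curve.negHom L.curve.lift_pointEquiv_comp_addHom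
          L.curve.pointEquiv_comp_negHom_geom) ⟶
        (L.curve.abelianVarietyOfAddHom L.curve.addHom L.curve.negHom L.curve.lift_pointEquiv_comp_addHom
          L.curve.pointEquiv_comp_negHom_geom)),
      w * w = -(d : ℂ) ∧ L.ω₁ = 1 ∧ L.ω₂ = w ∧ N = !![0, 1; -(d : ℤ), 0] ∧
      (w * L.ω₁ = (N 0 0 : ℂ) * L.ω₁ + (N 0 1 : ℂ) * L.ω₂) ∧
      (w * L.ω₂ = (N 1 0 : ℂ) * L.ω₁ + (N 1 1 : ℂ) * L.ω₂) ∧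
      φ₀ ≫ φ₀ = -((d : ℤ) • 𝟙 (L.curve.abelianVarietyOfAddHom L.curve.addHom L.curve.negHom L.curve.lift_pointEquiv_comp_addHom
          L.curve.pointEquiv_comp_negHom_geom)) ∧
      ∀ z : ℂ, L.upoint z ≫ φ₀.hom.hom.hom = L.upoint (w * z) := by
  -- the multiplier `w = i√d` and the lattice `Λ = ℤ + ℤw`
  set w : ℂ := Complex.I * (Real.sqrt d : ℂ) with hwdef
  have hw2' : w * w = -(d : ℂ) := by
    have h7 : ((Real.sqrt d : ℝ) : ℂ) ^ 2 = d := by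
      rw [← Complex.ofReal_pow, Real.sq_sqrt (by positivity : (0 : ℝ) ≤ d)]; norm_num
    rw [hwdef]
    linear_combination (Real.sqrt d : ℂ) ^ 2 * Complex.I_sq - h7
  have hwim : w.im ≠ 0 := by
    rw [hwdef]
    simp only [Complex.mul_im, Complex.I_re, Complex.ofReal_im, mul_zero, Complex.I_im, Complex.ofReal_re,
      one_mul, zero_add]
    have : (0 : ℝ) < d := by exact_mod_cast hd
    positivity
  have hw0 : w ≠ 0 := fun h => hwim (by rw [h, Complex.zero_im])
  clear_value w
  let L : PeriodPair := ⟨1, w, linearIndependent_one_of_im_ne_zero hwim⟩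
  have hL1 : L.ω₁ = 1 := rfl
  have hL2 : L.ω₂ = w := rfl
  set E : AbelianVariety ℂ := L.curve.abelianVarietyOfAddHom L.curve.addHom L.curve.negHom
    L.curve.lift_pointEquiv_comp_addHom L.curve.pointEquiv_comp_negHom_geom with hE
  -- `wΛ ⊆ Λ`: `w(m + nw) = -dn + mw`
  have hwΛ : ∀ l ∈ L.lattice, w * l ∈ L.lattice := by
    intro l hl
    obtain ⟨m, n, rfl⟩ := PeriodPair.mem_lattice.mp hl
    refine PeriodPair.mem_lattice.mpr ⟨-(d : ℤ) * n, m, ?_⟩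
    rw [hL1, hL2]
    push_cast
    linear_combination (-(n : ℂ)) * hw2'
  -- the endomorphism
  obtain ⟨φ, hφ⟩ := exists_endomorphism_of_mul_mem_lattice L hw0 hwΛ
  refine ⟨L, w, !![0, 1; -(d : ℤ), 0], φ, hw2', hL1, hL2, rfl, ?_, ?_, ?_, hφ⟩
  · rw [hL1, hL2]
    simp only [Matrix.of_apply, Matrix.cons_val', Matrix.cons_val_zero, Matrix.cons_val_one,
      Matrix.cons_val_fin_one]
    push_cast
    ring
  · rw [hL1, hL2]
    simp only [Matrix.of_apply, Matrix.cons_val', Matrix.cons_val_zero, Matrix.cons_val_one,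
      Matrix.cons_val_fin_one]
    push_cast
    linear_combination hw2'
  -- `φ ≫ φ = -d` on `ℂ`-points, hence as morphisms
  apply AbelianVariety.hom_ext
  haveI : IsReduced E.X.left := AbelianVariety.isReduced_left E
  refine SchemeOver.hom_ext_of_forall_algPoints ℂ fun p => ?_
  obtain ⟨z, rfl⟩ := L.upoint_surjective p
  letI instGrp : GrpObj L.curve.scheme := E.grpObj
  let φ' : L.curve.scheme ⟶ L.curve.scheme := φ.hom.hom.hom
  have hφ' : ∀ z : ℂ, L.upoint z ≫ φ' = L.upoint (w * z) := hφ
  have lhs : L.upoint z ≫ (φ ≫ φ).hom.hom.hom = L.upoint (w * (w * z)) := by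
    change (L.upoint z ≫ φ') ≫ φ' = _
    rw [hφ', hφ']
  let pe : L.curve.toAffine.Point ≃ AlgPoints L.curve.scheme ℂ := L.curve.pointEquiv (L := ℂ)
  have hupt : ∀ z : ℂ, L.upoint z = pe (L.toPoint z) := fun z => rfl
  have hmul : ∀ x y : L.curve.toAffine.Point, pe (x + y) = pe x * pe y := by
    intro x y
    change L.curve.pointEquiv (x + y) = lift (L.curve.pointEquiv x) (L.curve.pointEquiv y) ≫ L.curve.addHom
    exact (L.curve.lift_pointEquiv_comp_addHom_of_field (L := ℂ) x y).symm
  let peHom : L.curve.toAffine.Point →+ Additive (AlgPoints L.curve.scheme ℂ) :=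
    { toFun := fun x => Additive.ofMul (pe x)
      map_zero' := by
        have e := hmul 0 0
        rw [add_zero] at e
        have e' : pe 0 * pe 0 = pe 0 * 1 := by rw [mul_one]; exact e.symm
        exact congrArg Additive.ofMul (mul_left_cancel e')
      map_add' := fun x y => by
        change Additive.ofMul (pe (x + y)) = Additive.ofMul (pe x) + Additive.ofMul (pe y)
        rw [hmul]; rfl }
  have h1pt : pe 0 = 1 := by
    have e := hmul 0 0
    rw [add_zero] at e
    have e' : pe 0 * pe 0 = pe 0 * 1 := by rw [mul_one]; exact e.symm
    exact mul_left_cancel e'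
  -- points of `k • 𝟙 E`: `π(z) ↦ π(kz)`
  let uk : ℕ → (L.curve.scheme ⟶ L.curve.scheme) := fun k => (k • 𝟙 E : E ⟶ E).hom.hom.hom
  have hnsmul : ∀ k : ℕ, L.upoint z ≫ uk k = L.upoint ((k : ℂ) * z) := by
    intro k
    induction k with
    | zero =>
      change L.upoint z ≫ ((0 • 𝟙 E : E ⟶ E)).hom.hom.hom = _
      rw [zero_nsmul]
      change L.upoint z ≫ (1 : L.curve.scheme ⟶ L.curve.scheme) = _
      rw [MonObj.comp_one, Nat.cast_zero, zero_mul, hupt 0, PeriodPair.toPoint_zero, h1pt]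
    | succ k ih =>
      change L.upoint z ≫ (((k + 1) • 𝟙 E : E ⟶ E)).hom.hom.hom = _
      rw [succ_nsmul]
      change L.upoint z ≫ (uk k * (𝟙 L.curve.scheme : L.curve.scheme ⟶ L.curve.scheme)) = _
      rw [MonObj.comp_mul, ih, Category.comp_id, hupt, hupt, ← hmul, hupt,
        ← PeriodPair.toPointHom_apply L.toPoint_add_holds, ← PeriodPair.toPointHom_apply L.toPoint_add_holds,
        ← PeriodPair.toPointHom_apply L.toPoint_add_holds, ← map_add]
      congr 2
      push_cast
      ring
  have rhs : L.upoint z ≫ (-((d : ℤ) • 𝟙 E)).hom.hom.hom = L.upoint (-(d : ℂ) * z) := by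
    rw [natCast_zsmul]
    change L.upoint z ≫ (uk d)⁻¹ = _
    rw [GrpObj.comp_inv, hnsmul, hupt, hupt, neg_mul, ← PeriodPair.toPointHom_apply L.toPoint_add_holds,
      ← PeriodPair.toPointHom_apply L.toPoint_add_holds, map_neg]
    exact (congrArg Additive.toMul (map_neg peHom _)).symm
  change L.upoint z ≫ (φ ≫ φ).hom.hom.hom = L.upoint z ≫ (-((d : ℤ) • 𝟙 E)).hom.hom.hom
  rw [lhs, rhs, ← mul_assoc, hw2']

end

/-- **The CM curve with `[√-d]`, short form**: for every `d ≥ 1` there is a complex abelian variety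
`E₀` of dimension `1` with an endomorphism `ψ₀`, `ψ₀ ≫ ψ₀ = -(d • 𝟙 E₀)` — the elliptic curve
`ℂ/(ℤ + ℤ√-d)` with its complex multiplication `[√-d]` (`exists_cmCurve_sqrt`; `dim E_Λ = 1` by
`Motives.dim_abelianVarietyOfAddHom`). This is the hypothesis `(CM)` of
`Motives.exists_cmWeilSurface_aimedSplitProduct_of_ne_one_of_ne_three_of_cmCurve_of_aiming` and the
partner-curve input of `HodgeTheory.exists_weilType_cmSquare` / `Motives.exists_cmSquare_surfaceConjunct`.
[cite: SilvermanAEC2009, Thm. VI.4.1 (b)] [cite: Cox2013, Prop. 14.9] [cite: vanGeemen1994HodgeAV, 5.3] -/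
theorem exists_cmCurve_sqrt_neg (d : ℕ) (hd : 0 < d) :
    ∃ (E₀ : AbelianVariety ℂ) (ψ₀ : E₀ ⟶ E₀), E₀.dim = 1 ∧ ψ₀ ≫ ψ₀ = -(d • 𝟙 E₀) := by
  obtain ⟨L, w, N, φ₀, -, -, -, -, -, -, hφ, -⟩ := exists_cmCurve_sqrt d hd
  exact ⟨_, φ₀, dim_abelianVarietyOfAddHom L.curve _ _ _ _, by rw [hφ, natCast_zsmul]⟩

/-- The same with the integer scalar, `ψ₀ ≫ ψ₀ = -((d : ℤ) • 𝟙 E₀)` (the spelling of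
`Motives.exists_cmWeilSurface_aimedSplitProduct_of_ne_one_of_ne_three`). [cite: SilvermanAEC2009, Thm. VI.4.1 (b)] -/
theorem exists_cmCurve_sqrt_neg_zsmul (d : ℕ) (hd : 0 < d) :
    ∃ (E₀ : AbelianVariety ℂ) (ψ₀ : E₀ ⟶ E₀), E₀.dim = 1 ∧ ψ₀ ≫ ψ₀ = -((d : ℤ) • 𝟙 E₀) := by
  obtain ⟨L, w, N, φ₀, -, -, -, -, -, -, hφ, -⟩ := exists_cmCurve_sqrt d hd
  exact ⟨_, φ₀, dim_abelianVarietyOfAddHom L.curve _ _ _ _, hφ⟩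

end Literature.NumberTheory.EllipticCurves.CMEndomorphism

end
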